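import Mathlib
import HarnessLib
import Summits.ABC.ABC.Theses.TwistAmplification

/-!
# Sketch — crux-ideate stmt-ABC-1975 (SharpModerateLaw), ideator 3, round 1

First lemmas of the two idea cards (`resolvent-root-census`, `euclidean-stratum-mordell-orbit`)
and the common transfer statement `BoxRadicalLaw` (C⁺). Statements only (defs of `Prop`);
nothing here is proved.
-/

namespace Summit.ABC.ABC.Cruxes.SharpModerateLaw.Sketch

open UniqueFactorizationMonoid

/-- TRANSFER C⁺ (`BoxRadicalLaw`, both cards): the pure box form of the crux. For
`λ ∈ (1/6, 1/3]` the integer pairs `(x, y)` with `|x|³, y² ≤ T`, `x³ ≠ y²` and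
`rad(x³ − y²) ≤ T^λ` number `≪_ε T^{λ − 1/6 + ε}`. Via the injection (isomorphism class of
`E/ℚ`) ↦ (c₄, c₆) of its minimal model, `N_E ≥ rad(Δ_min)/6`, `1728 Δ = c₄³ − c₆²` and a dyadic
sum over `T ≤ X^σ` this implies `SharpModerateLaw` for every `3 < κ < 6 < σ`; it is Mazur's
Conjecture 1 (Kane, arXiv:1104.2635) for the parameters `(1/2, λ, 1/3)` restricted to an exact
square and an exact cube, in the unproved range `a + b + c = 5/6 + λ ∈ (1, 7/6]`. -/
def BoxRadicalLaw : Prop :=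
  ∀ lam ε : ℝ, 1 / 6 < lam → lam ≤ 1 / 3 → 0 < ε → ∃ C : ℝ, ∀ T : ℝ, 1 ≤ T →
    (Set.ncard {p : ℤ × ℤ | p.1 ^ 3 ≠ p.2 ^ 2 ∧ (|(p.1 : ℝ)|) ^ 3 ≤ T ∧ ((p.2 : ℝ)) ^ 2 ≤ T ∧
        ((radical (M := ℕ) ((p.1 ^ 3 - p.2 ^ 2).natAbs) : ℕ) : ℝ) ≤ T ^ lam} : ℝ)
      ≤ C * T ^ (lam - 1 / 6 + ε)

/-- The transfer arrow claimed by both cards (bookkeeping: minimal `(c₄,c₆)` injects, `rad Δ ≤ 6N`,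
dyadic `T`). -/
def BoxRadicalLaw_implies_crux : Prop :=
  BoxRadicalLaw → Summit.ABC.ABC.Theses.TwistAmplification.SharpModerateLaw

/-! ## Card A — resolvent-root census: first lemmas (Frey slice = split cubic algebra) -/

/-- DEEP LATTICES CARRY ONE LINE. For the census lattice
`Λ_q = {(u,v) : q₁ ∣ u, q₂ ∣ v, q₃ ∣ u+v}` (index `q₁q₂q₃` in `ℤ²` when the `qᵢ` are pairwise
coprime): if `q₁q₂q₃ > 2H²` then all its vectors in the `H`-box are collinear — so a deep skeleton
`(q₁,q₂,q₃)` contributes at most one primitive abc-solution `q₁a + q₂b = q₃c`, and the Mazur–Kane /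
Frey-slice count above level `θ = 2` IS the census `#{q : Λ_q has a box vector off the axes}`.
(Proof: `uv' − u'v` is divisible by `q₁q₂q₃` and has absolute value `≤ 2H²`.) -/
def DeepLatticeCollinear : Prop :=
  ∀ q₁ q₂ q₃ H : ℕ, Nat.Coprime q₁ q₂ → Nat.Coprime q₂ q₃ → Nat.Coprime q₁ q₃ →
    2 * H ^ 2 < q₁ * q₂ * q₃ →
    ∀ u v u' v' : ℤ,
      (|u| ≤ H ∧ |v| ≤ H ∧ (q₁ : ℤ) ∣ u ∧ (q₂ : ℤ) ∣ v ∧ (q₃ : ℤ) ∣ u + v) →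
      (|u'| ≤ H ∧ |v'| ≤ H ∧ (q₁ : ℤ) ∣ u' ∧ (q₂ : ℤ) ∣ v' ∧ (q₃ : ℤ) ∣ u' + v') →
      u * v' = u' * v

/-- CUSP = MAJOR ARC. `Λ_q` has a box vector off the three lines iff the CRT-glued resolvent root
`t_q = −q₁ q₂⁻¹ (mod q₃)` (for the split algebra the "root of the resolvent cubic `t(t+1)` mod `q`")
visits the major arc `{a : 0 < |a| ≤ H/q₁, |residue of a·t_q mod q₃| ≤ H/q₂}` — equivalently the
Hecke point `(t_q + i)/q₃ ∈ SL₂(ℤ)\ℍ`, rescaled by `diag(q₁,q₂)`, lies in the cusp above height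
`≍ q₁q₂q₃/H²`. This is the statement whose equidistribution (Hooley / Duke–Friedlander–Iwaniec
bilinear Kloosterman fractions) is the lever. -/
def CuspCriterion : Prop :=
  ∀ q₁ q₂ q₃ H : ℕ, 0 < q₁ → 0 < q₂ → 1 < q₃ → Nat.Coprime q₂ q₃ →
    ((∃ u v : ℤ, u ≠ 0 ∧ v ≠ 0 ∧ u + v ≠ 0 ∧ |u| ≤ H ∧ |v| ≤ H ∧
        (q₁ : ℤ) ∣ u ∧ (q₂ : ℤ) ∣ v ∧ (q₃ : ℤ) ∣ u + v) ↔
      (∃ a b : ℤ, a ≠ 0 ∧ b ≠ 0 ∧ (q₁ : ℤ) * a + q₂ * b ≠ 0 ∧ |a| * q₁ ≤ H ∧ |b| * q₂ ≤ H ∧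
        (b : ZMod q₃) = -((q₁ : ZMod q₃) * (q₂ : ZMod q₃)⁻¹ * (a : ZMod q₃))))

/-- THE CENSUS STATEMENT the lever must deliver (Frey slice, level window `θ ∈ (2, 1 + s)`,
`s = 6/κ ∈ (1,2)`): among the skeletons `q = (q₁,q₂,q₃)` — pairwise coprime, each `qᵢ` equal to its
own powerful part up to a cofactor, `q₁q₂q₃ ∈ (H^θ, 2H^θ]`, `rad(q₁q₂q₃) ≤ H^{s+θ−3}` — the number
whose lattice `Λ_q` has a box vector off the axes is `≪_ε H^{s−1+ε}`, i.e. the family size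
`H^{s+θ−3+o(1)}` times the cusp measure `H^{2−θ}`. Typed loosely (the skeleton condition is relaxed
to `rad q ≤ H^{s+θ−3}`, which only enlarges the family by `H^{o(1)}`). -/
def FreySliceCensus : Prop :=
  ∀ s θ ε : ℝ, 1 < s → s < 2 → 2 < θ → θ < 1 + s → 0 < ε → ∃ C : ℝ, ∀ H : ℝ, 1 ≤ H →
    (Set.ncard {q : ℕ × ℕ × ℕ | Nat.Coprime q.1 q.2.1 ∧ Nat.Coprime q.2.1 q.2.2 ∧
        Nat.Coprime q.1 q.2.2 ∧ H ^ θ < ((q.1 * q.2.1 * q.2.2 : ℕ) : ℝ) ∧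
        ((q.1 * q.2.1 * q.2.2 : ℕ) : ℝ) ≤ 2 * H ^ θ ∧
        ((radical (M := ℕ) (q.1 * q.2.1 * q.2.2) : ℕ) : ℝ) ≤ H ^ (s + θ - 3) ∧
        ∃ u v : ℤ, u ≠ 0 ∧ v ≠ 0 ∧ u + v ≠ 0 ∧ |(u : ℝ)| ≤ H ∧ |(v : ℝ)| ≤ H ∧
          (q.1 : ℤ) ∣ u ∧ (q.2.1 : ℤ) ∣ v ∧ (q.2.2 : ℤ) ∣ u + v} : ℝ) ≤ C * H ^ (s - 1 + ε)

/-! ## Card B — Euclidean stratum / Mordell (X(6)) orbits: first lemmas -/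

/-- The Mordell-orbit model: integers `a, b` with `a³ − b² = 1728·k·z⁶` (a rational point
`(a/z², b/z³)` of the CM curve `Y² = X³ − 1728k`) give the integral Weierstrass curve
`⟨0,0,0,−27a,−54b⟩` with `c₄ = 6⁴a`, `c₆ = 6⁶b`, `Δ = 6¹²·k·z⁶`. -/
def MordellOrbitInvariants : Prop :=
  ∀ a b k z : ℤ, a ^ 3 - b ^ 2 = 1728 * k * z ^ 6 →
    (⟨0, 0, 0, -27 * a, -54 * b⟩ : WeierstrassCurve ℤ).c₄ = 6 ^ 4 * a ∧
    (⟨0, 0, 0, -27 * a, -54 * b⟩ : WeierstrassCurve ℤ).c₆ = 6 ^ 6 * b ∧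
    (⟨0, 0, 0, -27 * a, -54 * b⟩ : WeierstrassCurve ℤ).Δ = 6 ^ 12 * k * z ^ 6

/-- ... and at every prime `p ∤ 6a` (in particular at every `p ∣ z` when `gcd(a, z) = 1`, i.e. the
point is in lowest terms) the model has `v_p(c₄) = 0` — multiplicative (or good) reduction, already
minimal at `p` — with `v_p(Δ) = v_p(k) + 6·v_p(z)`: the orbit multiplies the discriminant by sixth
powers while the conductor only gains `rad(z)`; the Szpiro ratio along `n ↦ n·P₀` climbs to `6⁻`. -/
def MordellOrbitValuation : Prop :=
  ∀ a b k z : ℤ, k ≠ 0 → z ≠ 0 → a ^ 3 - b ^ 2 = 1728 * k * z ^ 6 →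
    ∀ p : ℕ, p.Prime → ¬ (p : ℤ) ∣ 6 * a →
      padicValInt p ((⟨0, 0, 0, -27 * a, -54 * b⟩ : WeierstrassCurve ℤ).c₄) = 0 ∧
      padicValInt p ((⟨0, 0, 0, -27 * a, -54 * b⟩ : WeierstrassCurve ℤ).Δ)
        = padicValInt p k + 6 * padicValInt p z

/-- The stratum law the card isolates (K1): rational points of naive height `≤ A·log K` on the
Mordell family `Y² = X³ − 1728k`, `0 < |k| ≤ K`, written in lowest terms `(a/z², b/z³)`, number
`≪_{A,ε} K^{5/6+ε}` in total — "small generators are rare" (heuristically: `ĥ(generator)·#Ш ≍ |k|^{1/6}`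
by BSD for the CM curve, so a generator of height `O(log K)` forces `#Ш ≥ K^{1/6−o(1)}` or a tiny
`L'(1)`). Together with `MordellOrbitValuation` it bounds the Euclidean stratum
`{Δ_min = k z⁶ : |k| ≤ X^{(6−κ)/5}}` of the window by `X^{1−κ/6+ε}`, which is sharp: generic seeds
realise `X^{1−κ/6−o(1)}` there. -/
def MordellFamilySmallPoints : Prop :=
  ∀ A ε : ℝ, 0 < A → 0 < ε → ∃ C : ℝ, ∀ K : ℝ, 2 ≤ K →
    (Set.ncard {t : ℤ × ℤ × ℤ × ℕ | t.1 ≠ 0 ∧ |(t.1 : ℝ)| ≤ K ∧ 0 < t.2.2.2 ∧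
        IsCoprime t.2.1 (t.2.2.2 : ℤ) ∧
        t.2.1 ^ 3 - t.2.2.1 ^ 2 = 1728 * t.1 * (t.2.2.2 : ℤ) ^ 6 ∧
        Real.log (max (|(t.2.1 : ℝ)|) ((t.2.2.2 : ℝ) ^ 2)) ≤ A * Real.log K} : ℝ)
      ≤ C * K ^ ((5 : ℝ) / 6 + ε)

end Summit.ABC.ABC.Cruxes.SharpModerateLaw.Sketch
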